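import Literature.AlgebraicGeometry.Motives.TateSemisimplicityInvariantsCoinvariants
import Literature.AlgebraicGeometry.Motives.KahnPartialSemisimplicityPoincareDuality
import Literature.LinearAlgebra.InvariantPerfectPairingFixedSpaces
import HarnessLib

/-!
# The Frobenius forms versus the Galois forms of `S` and `SS` over a finite field, under the two
# «`Γ_k` is generated by the Frobenius» hypotheses: `H^Γ = Ker(φ − 1)`, and «`φ`-stable ⟹ `Γ_k`-stable»

Topic `Literature/AlgebraicGeometry/Motives`; THEOREMS ONLY (no definition, no instance, no named
fact; D-0026).

Over `k = 𝔽_q`, B. Kahn (*Zeta and L-functions of varieties and motives* (2020) §6.14, held, p. 132)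
states `S^i(X, l)` with the GALOIS GROUP `G = Gal(k̄/k)` — «the composition
`H^{2i}_l(X)(i)^G ↪ H^{2i}_l(X)(i) → H^{2i}_l(X)(i)_G` is bijective» — and `SS^i(X, l)` as «the action
of `G` on `H^i_l(X)` is semisimple», while J. S. Milne (arXiv:0709.3040 §1, held, p. 3) states them with
the FROBENIUS: «Every Frobenius map `π` of `X` acts semisimply on `H^{2r}(X, ℚ_ℓ(r))_1` (i.e., it acts as
`1`)».  For the continuous `ℓ`-adic representations the two agree because the Frobenius generates
`Γ_k ≅ Ẑ` topologically (Serre, *Local Fields* XIII §1; tree `denseRange_zpowers_arithFrob_holds`):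
`H^Γ = Ker(φ − 1)` and every closed `φ`-stable subspace is `Γ_k`-stable.  The tree's abstract
`E : GaloisWeilCohomology k K χ` carries no topology on `Hⁱ(X)`, so these two consequences of
continuity are HYPOTHESES here (gen-37 pointer (γ): the tree only has `invariants_le_ker_sub_one`); under
them this file identifies the forms:

* §1 **`S`**: with `H^{2r}(X)(r)^Γ = Ker(φ_r − 1)` (`φ_r = χ(F)ʳ F` the twisted geometric Frobenius),
  KAHN'S `H^Γ ⊕ 𝔞H = H` ⟺ MILNE'S `Ker(φ_r − 1) ∩ (φ_r − 1)H = 0`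
  (`isCompl_invariants_coinvariantsKer_iff_ker_inf_range_eq_bot`), and then `𝔞H = (φ_r − 1)H`
  (`coinvariantsKer_eq_range_sub_one_of_…`); unconditionally `(φ_r − 1)H ⊆ 𝔞H`, `H^Γ ⊆ Ker(φ_r − 1)`
  and Kahn's form ⟹ `Ker(φ_r − 1) ∩ (φ_r − 1)H ⊆ Ker(φ_r − 1) ∩ 𝔞H`.  Key step (`Γ_k` abelian,
  row g38-#11 `absoluteGaloisGroup_mul_comm`): every `ρ(g)` commutes with `φ_r`, so `(φ_r − 1)H` is
  `Γ_k`-stable and, when `Γ_k` fixes `Ker(φ_r − 1)`, `ρ(g)v − v ∈ (φ_r − 1)H` for all `v` once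
  `H = Ker ⊕ Range`.
* §2 **`SS`**: with «every `φ`-stable subspace of `Hⁱ(X)` is `Γ_k`-stable», MILNE'S «`π` acts
  semisimply on `Hⁱ(X)`» ⟹ KAHN'S «`G` acts semisimply» (`tateSemisimplicityFor_of_isSemisimple_frobAction`),
  hence ⟺ together with row g38-#11 (`tateSemisimplicityFor_iff_isSemisimple_frobAction`).
* §3 **`T`**: with `H^{2r}(X)(r)^Γ = Ker(φ_r − 1)`, the tree's `TateConjectureFor` (`K·Aʳ = H^Γ`) ⟺
  the finite-field form `K·Aʳ = Ker(φ_r − 1)` (`tateConjectureFor_iff_algebraicClasses_eq_ker`).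

What this file does NOT do: it does not prove the two hypotheses (they are false for a general
abstract `E`) and proves no case of `S`, `SS`, `T`.  HC is not touched.

## Provenance

Lane `lit-hodgefound` (summit `HodgeConjecture`, Track 2 foundations library, Layer B: motives),
seat `lit-hodgefound-p29` (literature-prover, generation 38, row g38-#17).
-/

universe u v

open CategoryTheory AlgebraicGeometry
open Representation (Coinvariants)

noncomputable section

namespace Literature.AlgebraicGeometry.Motives

open Literature.LinearAlgebra Literature.LinearAlgebra.InvariantPairing

namespace GaloisWeilCohomology

variable {k : Type u} [Field k] [Finite k] {K : Type v} [Field K] [CharZero K]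
  {χ : Field.absoluteGaloisGroup k →* Kˣ} (E : GaloisWeilCohomology k K χ)
variable {d : ℕ} {X : SchemeOver k}

/-! ## §1 `S`: Kahn's form versus Milne's Frobenius form -/

/-- Over a finite field all twisted actions `χ(g)ʲ ρ(g)` on `Hⁱ(X)(j)` commute (`Γ_k` is abelian,
row g38-#11). [cite: SerreLocalFields1979, Ch. XIII §1] -/
theorem commute_ρTwist (X : SchemeOver k) (i : ℕ) (j : ℤ) (g g' : Field.absoluteGaloisGroup k) :
    Commute (E.ρTwist X i j g) (E.ρTwist X i j g') := by
  change E.ρTwist X i j g * E.ρTwist X i j g' = E.ρTwist X i j g' * E.ρTwist X i j g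
  rw [← map_mul, ← map_mul, absoluteGaloisGroup_mul_comm g g']

/-- `(φ − 1)Hⁱ(X)(j)` is `Γ_k`-stable over a finite field (`ρ(g)` commutes with `φ − 1`).
[cite: Kahn2020, §6.14 p. 132] [cite: SerreLocalFields1979, Ch. XIII §1] -/
theorem ρTwist_apply_mem_range_sub_one (X : SchemeOver k) (i : ℕ) (j : ℤ)
    (g : Field.absoluteGaloisGroup k) {v : E.obj X i}
    (hv : v ∈ LinearMap.range (E.ρTwist X i j (geomFrob k) - 1)) :
    E.ρTwist X i j g v ∈ LinearMap.range (E.ρTwist X i j (geomFrob k) - 1) := by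
  obtain ⟨w, rfl⟩ := hv
  refine ⟨E.ρTwist X i j g w, ?_⟩
  have hc := (E.commute_ρTwist X i j g (geomFrob k)).eq
  rw [LinearMap.sub_apply, Module.End.one_apply, LinearMap.sub_apply, Module.End.one_apply, map_sub,
    ← Module.End.mul_apply, ← hc, Module.End.mul_apply]

/-- **Kahn's form of `S` ⟹ Milne's**, given `Hⁱ(X)(j)^Γ = Ker(φ − 1)`: `H^Γ ∩ 𝔞H = 0` and
`(φ − 1)H ⊆ 𝔞H` give `Ker(φ − 1) ∩ (φ − 1)H = 0` (no finiteness needed).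
[cite: Kahn2020, §6.14 p. 132 S^i(X, l)] [cite: Milne2007TateFiniteFieldsAIM, §1 Conjecture S^r(X, ℓ)] -/
theorem ker_inf_range_eq_bot_of_isCompl_invariants_coinvariantsKer (X : SchemeOver k) (i : ℕ) (j : ℤ)
    (hI : (E.ρTwist X i j).invariants = LinearMap.ker (E.ρTwist X i j (geomFrob k) - 1))
    (h : IsCompl (E.ρTwist X i j).invariants (Coinvariants.ker (E.ρTwist X i j))) :
    LinearMap.ker (E.ρTwist X i j (geomFrob k) - 1) ⊓
      LinearMap.range (E.ρTwist X i j (geomFrob k) - 1) = ⊥ :=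
  eq_bot_iff.mpr (le_trans (inf_le_inf (le_of_eq hI.symm) (E.range_sub_one_le_coinvariantsKer X i j _))
    h.inf_eq_bot.le)

/-- **Under Milne's `S` and `H^Γ = Ker(φ − 1)` the augmentation submodule IS `(φ − 1)H`**:
`ρ(g)v − v = (ρ(g) − 1)(κ + (φ − 1)w) = (φ − 1)(ρ(g)w − … ) ∈ (φ − 1)H` because `Γ_k` fixes
`Ker(φ − 1) = H^Γ` and commutes with `φ` (`X` smooth projective).
[cite: Kahn2020, §6.14 p. 132 S^i(X, l)] [cite: Milne2007TateFiniteFieldsAIM, §1 Conjecture S^r(X, ℓ)] -/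
theorem coinvariantsKer_eq_range_sub_one_of_ker_inf_range_eq_bot (hX : IsSmoothProjective d X)
    (i : ℕ) (j : ℤ)
    (hI : (E.ρTwist X i j).invariants = LinearMap.ker (E.ρTwist X i j (geomFrob k) - 1))
    (hS : LinearMap.ker (E.ρTwist X i j (geomFrob k) - 1) ⊓
      LinearMap.range (E.ρTwist X i j (geomFrob k) - 1) = ⊥) :
    Coinvariants.ker (E.ρTwist X i j) = LinearMap.range (E.ρTwist X i j (geomFrob k) - 1) := by
  haveI := E.finite_obj hX i
  refine le_antisymm ?_ (E.range_sub_one_le_coinvariantsKer X i j _)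
  have hc := (InvariantPairing.ker_inf_range_eq_bot_iff_isCompl (E.ρTwist X i j (geomFrob k))).mp hS
  change Submodule.span K _ ≤ _
  rw [Submodule.span_le]
  rintro _ ⟨⟨g, v⟩, rfl⟩
  change E.ρTwist X i j g v - v ∈ LinearMap.range (E.ρTwist X i j (geomFrob k) - 1)
  have hv : v ∈ LinearMap.ker (E.ρTwist X i j (geomFrob k) - 1) ⊔
      LinearMap.range (E.ρTwist X i j (geomFrob k) - 1) := by
    rw [hc.sup_eq_top]
    exact Submodule.mem_top
  obtain ⟨κ, hκ, ρw, hρw, rfl⟩ := Submodule.mem_sup.mp hv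
  have hκ' : E.ρTwist X i j g κ = κ := by
    rw [← hI] at hκ
    exact hκ g
  rw [map_add, hκ', add_sub_add_left_eq_sub]
  exact Submodule.sub_mem _ (E.ρTwist_apply_mem_range_sub_one X i j g hρw) hρw

/-- **Milne's form of `S` ⟹ Kahn's**, given `Hⁱ(X)(j)^Γ = Ker(φ − 1)` (`X` smooth projective).
[cite: Kahn2020, §6.14 p. 132 S^i(X, l)] [cite: Milne2007TateFiniteFieldsAIM, §1 Conjecture S^r(X, ℓ)] -/
theorem isCompl_invariants_coinvariantsKer_of_ker_inf_range_eq_bot (hX : IsSmoothProjective d X)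
    (i : ℕ) (j : ℤ)
    (hI : (E.ρTwist X i j).invariants = LinearMap.ker (E.ρTwist X i j (geomFrob k) - 1))
    (hS : LinearMap.ker (E.ρTwist X i j (geomFrob k) - 1) ⊓
      LinearMap.range (E.ρTwist X i j (geomFrob k) - 1) = ⊥) :
    IsCompl (E.ρTwist X i j).invariants (Coinvariants.ker (E.ρTwist X i j)) := by
  haveI := E.finite_obj hX i
  rw [hI, E.coinvariantsKer_eq_range_sub_one_of_ker_inf_range_eq_bot hX i j hI hS]
  exact (InvariantPairing.ker_inf_range_eq_bot_iff_isCompl _).mp hS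

/-- **KAHN'S `S` ⟺ MILNE'S `S` when `H^Γ = Ker(φ − 1)`** (every twist `Hⁱ(X)(j)`, `X` smooth
projective over a finite field). [cite: Kahn2020, §6.14 p. 132 S^i(X, l)]
[cite: Milne2007TateFiniteFieldsAIM, §1 Conjecture S^r(X, ℓ)] [cite: SerreLocalFields1979, Ch. XIII §1] -/
theorem isCompl_invariants_coinvariantsKer_iff_ker_inf_range_eq_bot (hX : IsSmoothProjective d X)
    (i : ℕ) (j : ℤ)
    (hI : (E.ρTwist X i j).invariants = LinearMap.ker (E.ρTwist X i j (geomFrob k) - 1)) :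
    IsCompl (E.ρTwist X i j).invariants (Coinvariants.ker (E.ρTwist X i j)) ↔
      LinearMap.ker (E.ρTwist X i j (geomFrob k) - 1) ⊓
        LinearMap.range (E.ρTwist X i j (geomFrob k) - 1) = ⊥ :=
  ⟨E.ker_inf_range_eq_bot_of_isCompl_invariants_coinvariantsKer X i j hI,
    E.isCompl_invariants_coinvariantsKer_of_ker_inf_range_eq_bot hX i j hI⟩

/-- The same in Kahn's bijectivity form `H^{2r}(X)(r)^Γ ⥲ H^{2r}(X)(r)_Γ` and Kahn's degrees.
[cite: Kahn2020, §6.14 p. 132 S^i(X, l)] [cite: Milne2007TateFiniteFieldsAIM, §1 Conjecture S^r(X, ℓ)] -/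
theorem kahnS_iff_frobeniusS (hX : IsSmoothProjective d X) (r : ℕ)
    (hI : (E.ρTwist X (2 * r) r).invariants =
      LinearMap.ker (E.ρTwist X (2 * r) r (geomFrob k) - 1)) :
    Function.Bijective (Coinvariants.mk (E.ρTwist X (2 * r) r) ∘ₗ
        (E.ρTwist X (2 * r) r).invariants.subtype) ↔
      LinearMap.ker (E.ρTwist X (2 * r) r (geomFrob k) - 1) ⊓
        LinearMap.range (E.ρTwist X (2 * r) r (geomFrob k) - 1) = ⊥ := by
  rw [bijective_coinvariantsMk_comp_invariantsSubtype_iff_isCompl]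
  exact E.isCompl_invariants_coinvariantsKer_iff_ker_inf_range_eq_bot hX (2 * r) r hI

/-- Under Kahn's `S` and `H^Γ = Ker(φ − 1)` too, `𝔞H = (φ − 1)H`.
[cite: Kahn2020, §6.14 p. 132 S^i(X, l)] -/
theorem coinvariantsKer_eq_range_sub_one_of_isCompl (hX : IsSmoothProjective d X) (i : ℕ) (j : ℤ)
    (hI : (E.ρTwist X i j).invariants = LinearMap.ker (E.ρTwist X i j (geomFrob k) - 1))
    (h : IsCompl (E.ρTwist X i j).invariants (Coinvariants.ker (E.ρTwist X i j))) :
    Coinvariants.ker (E.ρTwist X i j) = LinearMap.range (E.ρTwist X i j (geomFrob k) - 1) :=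
  E.coinvariantsKer_eq_range_sub_one_of_ker_inf_range_eq_bot hX i j hI
    (E.ker_inf_range_eq_bot_of_isCompl_invariants_coinvariantsKer X i j hI h)

/-! ## §2 `SS`: Milne's form versus Kahn's form -/

/-- **«`π` acts semisimply on `Hⁱ(X)`» ⟹ «`G` acts semisimply on `Hⁱ(X)`» when every `φ`-stable
subspace is `Γ_k`-stable**: a `φ`-invariant complement of a subrepresentation is then a
subrepresentation. [cite: Kahn2020, §6.14 p. 132 SS^i(X, l)] [cite: Milne2007TateFiniteFieldsAIM, §1]
[cite: SerreLocalFields1979, Ch. XIII §1] -/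
theorem tateSemisimplicityFor_of_isSemisimple_frobAction (X : SchemeOver k) (i : ℕ)
    (hstab : ∀ W : Submodule K (E.obj X i), W ∈ Module.End.invtSubmodule (E.frobAction X i) →
      ∀ g : Field.absoluteGaloisGroup k, W ∈ Module.End.invtSubmodule (E.ρ X i g))
    (h : Module.End.IsSemisimple (E.frobAction X i)) : E.TateSemisimplicityFor X i := by
  refine ⟨fun U ↦ ?_⟩
  have hU : U.toSubmodule ∈ Module.End.invtSubmodule (E.frobAction X i) :=
    (Module.End.mem_invtSubmodule_iff_forall_mem_of_mem _).mpr fun v hv ↦ by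
      rw [frobAction_def]
      exact U.apply_mem_toSubmodule (geomFrob k) hv
  obtain ⟨W, hW, hc⟩ := Module.End.isSemisimple_iff.mp h U.toSubmodule hU
  let W' : Subrepresentation (E.ρ X i) :=
    { toSubmodule := W
      apply_mem_toSubmodule := fun g v hv ↦
        (Module.End.mem_invtSubmodule_iff_forall_mem_of_mem _).mp (hstab W hW g) v hv }
  refine ⟨W', disjoint_iff.mpr (Subrepresentation.toSubmodule_injective ?_),
    codisjoint_iff.mpr (Subrepresentation.toSubmodule_injective ?_)⟩
  · rw [Subrepresentation.toSubmodule_inf]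
    exact hc.inf_eq_bot
  · rw [Subrepresentation.toSubmodule_sup]
    exact hc.sup_eq_top

/-- **MILNE'S `SS` ⟺ KAHN'S `SS` when every `φ`-stable subspace is `Γ_k`-stable** (`X` smooth
projective over a finite field; ⟸ is row g38-#11, unconditional).
[cite: Kahn2020, §6.14 p. 132 SS^i(X, l)] [cite: Milne2007TateFiniteFieldsAIM, §1]
[cite: SerreLocalFields1979, Ch. XIII §1] -/
theorem tateSemisimplicityFor_iff_isSemisimple_frobAction (hX : IsSmoothProjective d X) (i : ℕ)
    (hstab : ∀ W : Submodule K (E.obj X i), W ∈ Module.End.invtSubmodule (E.frobAction X i) →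
      ∀ g : Field.absoluteGaloisGroup k, W ∈ Module.End.invtSubmodule (E.ρ X i g)) :
    E.TateSemisimplicityFor X i ↔ Module.End.IsSemisimple (E.frobAction X i) :=
  ⟨E.isSemisimple_frobAction_of_tateSemisimplicityFor hX,
    E.tateSemisimplicityFor_of_isSemisimple_frobAction X i hstab⟩

/-! ## §3 `T`: the `Γ_k`-invariants form versus the Frobenius-invariants form -/

omit [Finite k] in
/-- **`T^r(X)` ⟺ `K·Aʳ(X) = Ker(χ(g)ʳ g − 1)` when `H^{2r}(X)(r)^Γ = Ker(χ(g)ʳ g − 1)`** (any field,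
any `g`; over a finite field `g` the Frobenius: the tree's `TateConjectureFor` versus the finite-field
form used since gen 37; ⟸ is the tree's `tateConjectureFor_of_algebraicClasses_eq_ker`, unconditional).
[cite: Tate1994, §1 Conjecture T^r] [cite: Milne1986ValuesZetaFunctionsFiniteFields, §8 T′(X, r, ℓ)] -/
theorem tateConjectureFor_iff_algebraicClasses_eq_ker {k : Type u} [Field k]
    {χ : Field.absoluteGaloisGroup k →* Kˣ} (E : GaloisWeilCohomology k K χ) {X : SchemeOver k}
    (r : ℕ) (g : Field.absoluteGaloisGroup k)
    (hI : (E.ρTwist X (2 * r) r).invariants = LinearMap.ker (E.ρTwist X (2 * r) r g - 1)) :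
    E.TateConjectureFor X r ↔ E.algebraicClasses X r = LinearMap.ker (E.ρTwist X (2 * r) r g - 1) := by
  rw [← hI]
  rfl

end GaloisWeilCohomology

end Literature.AlgebraicGeometry.Motives

end
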